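import Summits.QuantumFields.BalabanUV.T4Continuum.Support.NE7SliceGreenPairingLocalised
import HarnessLib

/-!
# NE7SliceGreenFlatLocalisedStraight — THE LOCALISED SLICE SOLVER LETTER G♭-loc ON THE STRAIGHT-TANGENT TEST CLASS: F254c–d's two-region chain with the Hessian
# source hypothesis read on skew periodic `Y` with `(Qcoarse L)^[k+1] Y = 0` (vanishing straight `(k+1)`-fold average) instead of flat tangents — NO tangent
# corrector (the test directions `Y^{a′}_{ii′}` of `ker Q_k` fields ARE straight-tangent, G3a `Qcoarse_iterate_test_eq_zero`), hence no corner cost, far threshold `ℓ`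
# itself, and constant `C₄ = 1`

Cell `pub-balaban`, rung (B)+1 sub-cell t4, lineage `b2b-balaban-t4-ne7-p1` (CRUX PROVER NE7 #1 = OWNER of row NE7), generation 89; memo
`t4/b2b-balaban-t4-ne7-p1-g89/COSTING-N1.md` §7 (the v4 test class).  File F261 (over F253b `NE7SliceGreenTorusLocalised.exists_sliceGreen_localised_const` — torus core:
GAN24's (1.110) decay + lit-balaban's `H_k` decay —, F254c `NE7SliceGreenPairingLocalised.sum_far_norm_pull_eq`, G3a `NE7SliceGreenTestField`, G3c `NE7SliceGreenFlat.exists_kerQ_entry`,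
`NE7TorusBoxDictionary`).

WHY (memo §7).  The torus road's criticality defect is small on STRAIGHT-tangent tests (the frame term of `Q̄_1Y` vanishes only there unless the top is flat), so the
bootstrap F260 `NE7ApeFlatSkeletonTestClass` is run with the test class `T Y :≡ (Qcoarse L)^[k+1] Y = 0`; its `hGloc` binder then wants G♭-loc with the two-region Hessian
hypothesis on that class.  This is EASIER than F254d: the entry test direction of a `ker Q_k` torus field is itself in the class, so the hypothesis is applied to it
directly; near norm `≤ 2card n·‖a′‖₁` (the period box), far norm `≤ 2card n·‖a′|_{far(ℓ)}‖₁` (F254c's pull-back count).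
WHAT ([folklore]; 0 def, 0 sorry).  §1 `abs_re_pairing_le_straight` (`|Re(c̄S)| ≤ (card n)²(a‖a′‖₁ + b‖a′|_{far}‖₁)`); §2 `norm_curl_pairing_le_straight`; §3 the END
**`sliceGreen_flat_localised_straight`**: `∃ K ≥ 0, c > 0` (on `d`, `card n`): for every `k`, `N`, centre block `y₀`, radius `ℓ`, skew `(L^{k+1}N)`-periodic flat-tangent `X`,
`Bn, Bf ⊆ [0,L^{k+1}N)^{d+1}` with `ℓ ≤ |⌊x∕L^{k+1}⌋ − rep y₀|_T` on `Bf`, `a, b ≥ 0` with `|hess 1 X Y| ≤ a‖Y‖_{1,Bn} + b‖Y‖_{1,Bf}` on skew periodic straight-tangent `Y`: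
`‖curlAt 1 X z μ ν‖ ≤ K·L^{k+1}·(a + e^{−cℓ}b)` on the block `y₀`.
HONEST FRAMING (page 1): bookkeeping over GAN24 + lit-balaban kernel theorems (abelian, flat, `U = 1`); nothing of Bałaban's asserted; NOT (APE), NOT ONE-STEP, NOT NE7;
spine 0∕9; finite T⁴ rung (B)+1 — NOT infinite volume, NOT mass gap, NOT `BetaPertH`, NOT Clay.  Continuum YM on T⁴ ⇐ BetaPertH ∧ nine spine estimates (0/9 proved);
BetaPertH ⇐ (D1) ∧ (D4) ∧ CAP+tail; G-an2-4 gates asym, D1 and NE2/3/4.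
-/

set_option autoImplicit false

open scoped BigOperators Matrix ComplexConjugate Matrix.Norms.L2Operator
open Finset

namespace Summit.QuantumFields.BalabanUV.T4Continuum.NE7SliceGreenFlatLocalisedStraight

open Literature.MathematicalPhysics.QuantumFieldTheory.Balaban1983to89
open B7Prop1Explicit (Site e e_apply)
open T4AveragingDeficitWall (curlAt curl IsSkewDir SmallField dirL1)
open T4AveragingDeficitWallBoundary (periodBox mem_periodBox)
open AveragingDeficitPeriodicCounting (IsPeriodicDir)
open B5Prop11Plancherel (Tor fine unitVec)
open B5Action121 (Fs Fs_apply CurlOp CurlOp_mulVec)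
open B5Block118 (QvOp bpt)
open B5Blocks16 (blockOf blockOf_bpt)
open B6LowerBound2153Torus (toT rep toT_rep sum_pbox_toT)
open B4TorusKernel.MultiPeriod (torusSupNorm torusSupNorm_nonneg)
open BlockAveragePushDirSplit (flat)
open NE3TangentFlatStructure (framePot Qcoarse)
open NE3TangentCovariantTower (dirIter)
open NE3FlatHessianCurl (smallField_flatCfg_zero)
open NE3TangentFlatPush (flatCfg_eq_flat)
open NE3HessForm (hess)
open MinimalActionLevels (perWin)
open NE7ApeFlatSkeleton (hess_flat)
open NE7FlatHkOrthogonal (Fs_eq_mul_Fs_one)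
open NE7FlatHkCurlLetter (opNorm_le_card_mul)
open NE7TorusBoxDictionary (curlAt_flat_entry_torus sum_periodBox_toT periodBox_eq_pbox)
open NE7SliceGreenFlat (exists_kerQ_entry)
open NE7SliceGreenTestField (Fs_one_smul isSkewDir_test isPeriodicDir_test norm_test_le Qcoarse_iterate_test_eq_zero hess_flat_test curl_pairing_eq)
open NE7SliceGreenTorusLocalised (exists_sliceGreen_localised_const)
open NE7SliceGreenPairingLocalised (sum_far_norm_pull_eq)
open Beta.FluctuationProjection (digitOf bpt_blockOf_digitOf)

noncomputable section

variable {d : ℕ} {n : Type*} [Fintype n] [DecidableEq n]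

/-! ## §1 The real part of the twisted entry pairing, two-region, straight-tangent tests -/

/-- **`|Re(c̄·S)| ≤ (card n)²·(a·‖a′‖₁ + b·‖a′|_{far(ℓ)}‖₁)`** — the two-region Hessian hypothesis on straight-tangent tests applied DIRECTLY to the test direction
`Y^{c·a′}_{ii′}` (skew, periodic, `(Qcoarse L)^[k+1] Y = 0` by G3a); near norm on the period box, far norm by F254c's pull-back count. [folklore] -/
theorem abs_re_pairing_le_straight [Nonempty n] {L : ℕ} (k N : ℕ) [NeZero N] [NeZero (L ^ (k + 1))] [NeZero (L ^ (k + 1) * N)]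
    {X : Site (d + 1) → Fin (d + 1) → Matrix n n ℂ} (hXs : IsSkewDir X) (hXP : IsPeriodicDir X ((L ^ (k + 1) * N : ℕ) : ℤ))
    (cS : Site (d + 1)) (ℓ : ℝ) (Bn Bf : Finset (Site (d + 1))) (hBn : Bn ⊆ periodBox (d := d + 1) (L ^ (k + 1) * N))
    (hBf : Bf ⊆ periodBox (d := d + 1) (L ^ (k + 1) * N))
    (hfar : ∀ x ∈ Bf, ℓ ≤ torusSupNorm (fun _ : Fin (d + 1) => N) ((fun i => x i / ((L ^ (k + 1) : ℕ) : ℤ)) - cS))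
    {a b : ℝ} (ha : 0 ≤ a) (hb : 0 ≤ b)
    (hsrc : ∀ Y : Site (d + 1) → Fin (d + 1) → Matrix n n ℂ, IsSkewDir Y → IsPeriodicDir Y ((L ^ (k + 1) * N : ℕ) : ℤ) →
      (Qcoarse L)^[k + 1] Y = 0 →
      |hess (flat (d := d + 1) (n := n)) X Y (perWin (d + 1) (L ^ (k + 1) * N))| ≤ a * dirL1 Y Bn + b * dirL1 Y Bf)
    (a' : Tor (fine (L ^ (k + 1)) (fun _ : Fin (d + 1) => N)) × Fin (d + 1) → ℂ) (ha' : QvOp (L ^ (k + 1)) (fun _ : Fin (d + 1) => N) *ᵥ a' = 0)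
    (c : ℂ) (hc : ‖c‖ = 1) (i i' : n) :
    |(conj c * ∑ p ∈ perWin (d + 1) (L ^ (k + 1) * N),
        conj (Fs (fun _ : Fin (d + 1) => L ^ (k + 1) * N) 1 a' p.2.1.1 p.2.1.2 (toT (fun _ : Fin (d + 1) => L ^ (k + 1) * N) p.1))
          * Fs (fun _ : Fin (d + 1) => L ^ (k + 1) * N) 1
              (fun q : Tor (fun _ : Fin (d + 1) => L ^ (k + 1) * N) × Fin (d + 1) => X (rep (fun _ : Fin (d + 1) => L ^ (k + 1) * N) q.1) q.2 i i')
              p.2.1.1 p.2.1.2 (toT (fun _ : Fin (d + 1) => L ^ (k + 1) * N) p.1)).re|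
      ≤ (Fintype.card n : ℝ) ^ 2
          * (a * ∑ j, ‖a' j‖
            + b * ∑ j ∈ (Finset.univ : Finset (Tor (fine (L ^ (k + 1)) (fun _ : Fin (d + 1) => N)) × Fin (d + 1))).filter
                (fun j => ℓ ≤ torusSupNorm (fun _ : Fin (d + 1) => N)
                  (rep (fun _ : Fin (d + 1) => N) (B5Blocks16.blockOf (L ^ (k + 1)) (fun _ : Fin (d + 1) => N) j.1) - cS)), ‖a' j‖) := by
  classical
  have hflat0 : SmallField (flat (d := d + 1) (n := n)) 0 := by rw [← flatCfg_eq_flat]; exact smallField_flatCfg_zero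
  set Sf := (Finset.univ : Finset (Tor (fine (L ^ (k + 1)) (fun _ : Fin (d + 1) => N)) × Fin (d + 1))).filter
    (fun j => ℓ ≤ torusSupNorm (fun _ : Fin (d + 1) => N)
      (rep (fun _ : Fin (d + 1) => N) (B5Blocks16.blockOf (L ^ (k + 1)) (fun _ : Fin (d + 1) => N) j.1) - cS)) with hSfdef
  have hca : QvOp (L ^ (k + 1)) (fun _ : Fin (d + 1) => N) *ᵥ (c • a') = 0 := by rw [Matrix.mulVec_smul, ha', smul_zero]
  -- the test direction of `c·a′`: skew, periodic, STRAIGHT-tangent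
  set Y₁ : Site (d + 1) → Fin (d + 1) → Matrix n n ℂ := fun (x : Site (d + 1)) (κ : Fin (d + 1)) =>
      Matrix.single i i' ((c • a') (toT (fine (L ^ (k + 1)) (fun _ : Fin (d + 1) => N)) x, κ))
        - Matrix.single i' i (star ((c • a') (toT (fine (L ^ (k + 1)) (fun _ : Fin (d + 1) => N)) x, κ))) with hY₁def
  have hY₁s : IsSkewDir Y₁ := isSkewDir_test (fine (L ^ (k + 1)) (fun _ : Fin (d + 1) => N)) (c • a') i i'
  have hY₁P : IsPeriodicDir Y₁ ((L ^ (k + 1) * N : ℕ) : ℤ) := isPeriodicDir_test (d := d + 1) (L ^ (k + 1) * N) (c • a') i i'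
  have hY₁Q : (Qcoarse L)^[k + 1] Y₁ = 0 := Qcoarse_iterate_test_eq_zero (d := d + 1) L k N (c • a') hca i i'
  -- the hypothesis, applied to the test direction itself
  have hsY : |hess (flat (d := d + 1) (n := n)) X Y₁ (perWin (d + 1) (L ^ (k + 1) * N))| ≤ a * dirL1 Y₁ Bn + b * dirL1 Y₁ Bf :=
    hsrc Y₁ hY₁s hY₁P hY₁Q
  -- pointwise size of the test direction on any set of sites
  have htest : ∀ B : Finset (Site (d + 1)), dirL1 Y₁ B ≤ 2 * Fintype.card n * ∑ x ∈ B, ∑ κ : Fin (d + 1),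
      ‖a' (toT (fine (L ^ (k + 1)) (fun _ : Fin (d + 1) => N)) x, κ)‖ := by
    intro B
    unfold dirL1
    rw [Finset.mul_sum]
    refine Finset.sum_le_sum fun x _ => ?_
    rw [Finset.mul_sum]
    refine Finset.sum_le_sum fun κ _ => ?_
    have h := norm_test_le (fine (L ^ (k + 1)) (fun _ : Fin (d + 1) => N)) (c • a') i i' x κ
    have hca1 : ‖(c • a') (toT (fine (L ^ (k + 1)) (fun _ : Fin (d + 1) => N)) x, κ)‖ = ‖a' (toT (fine (L ^ (k + 1)) (fun _ : Fin (d + 1) => N)) x, κ)‖ := by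
      rw [Pi.smul_apply, norm_smul, hc, one_mul]
    rw [hca1] at h
    simp only [hY₁def]
    linarith
  have hmono1 : ∀ {B B' : Finset (Site (d + 1))}, B ⊆ B' → dirL1 Y₁ B ≤ dirL1 Y₁ B' := fun hBB' =>
    Finset.sum_le_sum_of_subset_of_nonneg hBB' fun _ _ _ => Finset.sum_nonneg fun _ _ => norm_nonneg _
  -- the NEAR norm on the whole period box
  have hYl1_near : dirL1 Y₁ Bn ≤ 2 * Fintype.card n * ∑ j, ‖a' j‖ := by
    refine (hmono1 hBn).trans ((htest _).trans (mul_le_mul_of_nonneg_left (le_of_eq ?_) (by positivity)))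
    have h := sum_periodBox_toT (d := d + 1) (L ^ (k + 1) * N) (fun t => ((∑ κ : Fin (d + 1), ‖a' (t, κ)‖ : ℝ) : ℂ))
    rw [Fintype.sum_prod_type]
    exact_mod_cast h
  -- the FAR norm: far test fields pay far mass (F254c's pull-back count)
  have hYl1_far : dirL1 Y₁ Bf ≤ 2 * Fintype.card n * ∑ j ∈ Sf, ‖a' j‖ := by
    have hBf' : Bf ⊆ (periodBox (d := d + 1) (L ^ (k + 1) * N)).filter (fun x => ℓ
        ≤ torusSupNorm (fun _ : Fin (d + 1) => N) ((fun i => x i / ((L ^ (k + 1) : ℕ) : ℤ)) - cS)) :=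
      fun x hx => Finset.mem_filter.mpr ⟨hBf hx, hfar x hx⟩
    have hpull := sum_far_norm_pull_eq (d := d) (L ^ (k + 1)) N a' cS ℓ
    refine (hmono1 hBf').trans ((htest _).trans (le_of_eq ?_))
    rw [hSfdef]
    push_cast at hpull ⊢
    rw [hpull]
  -- G3a: the Hessian against the test direction is `(2/card n)·Re(conj c·S)`
  rw [hY₁def, hess_flat_test (d := d + 1) (P := L ^ (k + 1) * N) hXs hXP (c • a') i i'] at hsY
  have hS : ∑ p ∈ perWin (d + 1) (L ^ (k + 1) * N),
      conj (Fs (fun _ : Fin (d + 1) => L ^ (k + 1) * N) 1 (c • a') p.2.1.1 p.2.1.2 (toT (fun _ : Fin (d + 1) => L ^ (k + 1) * N) p.1))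
        * Fs (fun _ : Fin (d + 1) => L ^ (k + 1) * N) 1
            (fun q : Tor (fun _ : Fin (d + 1) => L ^ (k + 1) * N) × Fin (d + 1) => X (rep (fun _ : Fin (d + 1) => L ^ (k + 1) * N) q.1) q.2 i i')
            p.2.1.1 p.2.1.2 (toT (fun _ : Fin (d + 1) => L ^ (k + 1) * N) p.1)
      = conj c * ∑ p ∈ perWin (d + 1) (L ^ (k + 1) * N),
        conj (Fs (fun _ : Fin (d + 1) => L ^ (k + 1) * N) 1 a' p.2.1.1 p.2.1.2 (toT (fun _ : Fin (d + 1) => L ^ (k + 1) * N) p.1))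
          * Fs (fun _ : Fin (d + 1) => L ^ (k + 1) * N) 1
              (fun q : Tor (fun _ : Fin (d + 1) => L ^ (k + 1) * N) × Fin (d + 1) => X (rep (fun _ : Fin (d + 1) => L ^ (k + 1) * N) q.1) q.2 i i')
              p.2.1.1 p.2.1.2 (toT (fun _ : Fin (d + 1) => L ^ (k + 1) * N) p.1) := by
    rw [Finset.mul_sum]
    refine Finset.sum_congr rfl fun p _ => ?_
    rw [Fs_one_smul, map_mul, mul_assoc]
  rw [hS] at hsY
  have hcardpos : (0 : ℝ) < Fintype.card n := by exact_mod_cast Fintype.card_pos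
  have key : |2 / Fintype.card n * (conj c * _).re| ≤ a * (2 * Fintype.card n * ∑ j, ‖a' j‖) + b * (2 * Fintype.card n * ∑ j ∈ Sf, ‖a' j‖) :=
    hsY.trans (add_le_add (mul_le_mul_of_nonneg_left hYl1_near ha) (mul_le_mul_of_nonneg_left hYl1_far hb))
  rw [abs_mul, abs_of_pos (by positivity : (0 : ℝ) < 2 / Fintype.card n)] at key
  refine le_of_mul_le_mul_left (key.trans (le_of_eq ?_)) (by positivity : (0 : ℝ) < 2 / Fintype.card n)
  field_simp

/-! ## §2 The curl pairing of the `ker Q_k` representative, two-region, straight-tangent tests -/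

/-- **`|⟨∂_n a, ∂_n x̃⟩| ≤ 4n²(card n)²·(a·‖a‖₁ + b·‖a|_{far}‖₁)`** for every `a ∈ ker Q_k`, whenever `x̃` has the plaquette field of the entry `x_{ii′}` of a skew periodic `X` whose
Hessian source is two-region bounded on straight-tangent tests (§1 at `c = 1, I`). [folklore] -/
theorem norm_curl_pairing_le_straight [Nonempty n] {L : ℕ} (k N : ℕ) [NeZero N] [NeZero (L ^ (k + 1))] [NeZero (L ^ (k + 1) * N)]
    {X : Site (d + 1) → Fin (d + 1) → Matrix n n ℂ} (hXs : IsSkewDir X) (hXP : IsPeriodicDir X ((L ^ (k + 1) * N : ℕ) : ℤ))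
    (cS : Site (d + 1)) (ℓ : ℝ) (Bn Bf : Finset (Site (d + 1))) (hBn : Bn ⊆ periodBox (d := d + 1) (L ^ (k + 1) * N))
    (hBf : Bf ⊆ periodBox (d := d + 1) (L ^ (k + 1) * N))
    (hfar : ∀ x ∈ Bf, ℓ ≤ torusSupNorm (fun _ : Fin (d + 1) => N) ((fun i => x i / ((L ^ (k + 1) : ℕ) : ℤ)) - cS))
    {a b : ℝ} (ha : 0 ≤ a) (hb : 0 ≤ b)
    (hsrc : ∀ Y : Site (d + 1) → Fin (d + 1) → Matrix n n ℂ, IsSkewDir Y → IsPeriodicDir Y ((L ^ (k + 1) * N : ℕ) : ℤ) →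
      (Qcoarse L)^[k + 1] Y = 0 →
      |hess (flat (d := d + 1) (n := n)) X Y (perWin (d + 1) (L ^ (k + 1) * N))| ≤ a * dirL1 Y Bn + b * dirL1 Y Bf)
    (i i' : n) (xt : Tor (fine (L ^ (k + 1)) (fun _ : Fin (d + 1) => N)) × Fin (d + 1) → ℂ)
    (hxt : ∀ (μ ν : Fin (d + 1)) (t : Tor (fine (L ^ (k + 1)) (fun _ : Fin (d + 1) => N))),
      Fs (fine (L ^ (k + 1)) (fun _ : Fin (d + 1) => N)) 1 xt μ ν t
        = Fs (fine (L ^ (k + 1)) (fun _ : Fin (d + 1) => N)) 1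
            (fun q : Tor (fine (L ^ (k + 1)) (fun _ : Fin (d + 1) => N)) × Fin (d + 1) =>
              X (rep (fine (L ^ (k + 1)) (fun _ : Fin (d + 1) => N)) q.1) q.2 i i') μ ν t)
    (a' : Tor (fine (L ^ (k + 1)) (fun _ : Fin (d + 1) => N)) × Fin (d + 1) → ℂ) (ha' : QvOp (L ^ (k + 1)) (fun _ : Fin (d + 1) => N) *ᵥ a' = 0) :
    ‖star (CurlOp (fine (L ^ (k + 1)) (fun _ : Fin (d + 1) => N)) ((L ^ (k + 1) : ℕ) : ℂ) *ᵥ a')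
        ⬝ᵥ (CurlOp (fine (L ^ (k + 1)) (fun _ : Fin (d + 1) => N)) ((L ^ (k + 1) : ℕ) : ℂ) *ᵥ xt)‖
      ≤ (4 * ((L ^ (k + 1) : ℕ) : ℝ) ^ 2 * (Fintype.card n : ℝ) ^ 2 * a) * ∑ j, ‖a' j‖
        + (4 * ((L ^ (k + 1) : ℕ) : ℝ) ^ 2 * (Fintype.card n : ℝ) ^ 2 * b)
          * ∑ j ∈ (Finset.univ : Finset (Tor (fine (L ^ (k + 1)) (fun _ : Fin (d + 1) => N)) × Fin (d + 1))).filter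
              (fun j => ℓ ≤ torusSupNorm (fun _ : Fin (d + 1) => N)
                (rep (fun _ : Fin (d + 1) => N) (B5Blocks16.blockOf (L ^ (k + 1)) (fun _ : Fin (d + 1) => N) j.1) - cS)), ‖a' j‖ := by
  -- the pairing is `2n²·S`
  have hp := curl_pairing_eq (d := d + 1) (L ^ (k + 1) * N) (((L ^ (k + 1) : ℕ) : ℂ)) a' xt
  rw [Finset.sum_congr rfl fun p _ => by rw [hxt]] at hp
  -- real and imaginary parts
  have hre := abs_re_pairing_le_straight k N hXs hXP cS ℓ Bn Bf hBn hBf hfar ha hb hsrc a' ha' 1 (by simp) i i'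
  rw [map_one, one_mul] at hre
  have him := abs_re_pairing_le_straight k N hXs hXP cS ℓ Bn Bf hBn hBf hfar ha hb hsrc a' ha' Complex.I (by simp) i i'
  rw [show ∀ S : ℂ, (conj Complex.I * S).re = S.im from fun S => by simp [Complex.conj_I]] at him
  have hSn := (Complex.norm_le_abs_re_add_abs_im _).trans (add_le_add hre him)
  have hA0 : 0 ≤ ∑ j, ‖a' j‖ := Finset.sum_nonneg fun _ _ => norm_nonneg _
  have hB0 : 0 ≤ ∑ j ∈ (Finset.univ : Finset (Tor (fine (L ^ (k + 1)) (fun _ : Fin (d + 1) => N)) × Fin (d + 1))).filter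
      (fun j => ℓ ≤ torusSupNorm (fun _ : Fin (d + 1) => N)
        (rep (fun _ : Fin (d + 1) => N) (B5Blocks16.blockOf (L ^ (k + 1)) (fun _ : Fin (d + 1) => N) j.1) - cS)), ‖a' j‖ :=
    Finset.sum_nonneg fun _ _ => norm_nonneg _
  rw [hp, norm_mul, norm_mul, Complex.norm_ofNat, norm_mul, Complex.norm_conj, Complex.norm_natCast]
  calc 2 * ((((L ^ (k + 1) : ℕ) : ℝ)) * ((L ^ (k + 1) : ℕ) : ℝ)) * _
      ≤ 2 * ((((L ^ (k + 1) : ℕ) : ℝ)) * ((L ^ (k + 1) : ℕ) : ℝ)) * _ := mul_le_mul_of_nonneg_left hSn (by positivity)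
    _ = _ := by ring

/-! ## §3 THE END: the localised slice solver letter at the trivial flat datum on straight-tangent tests, `k`-uniform -/

/-- **THE SLICE SOLVER LETTER G♭-loc AT THE TRIVIAL FLAT DATUM ON STRAIGHT-TANGENT TESTS, LOCALISED, `k`-UNIFORM** (`L ≥ 1`): there are `K ≥ 0` and `c > 0`, depending on
`d` and `card n` only, such that for every `k`, `N ≥ 1`, every centre block `y₀` of the coarse torus, every radius `ℓ`, every skew `(L^{k+1}N)`-periodic `X` with
`dirIter L (k+1) 1 X = 0`, every near set `Bn ⊆ [0,L^{k+1}N)^{d+1}`, every far set `Bf ⊆ [0,L^{k+1}N)^{d+1}` whose sites have their block at torus block-distance `≥ ℓ`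
from `rep y₀`, every `a, b ≥ 0` with `|hess 1 X Y (perWin)| ≤ a·‖Y‖_{1,Bn} + b·‖Y‖_{1,Bf}` for all skew `(L^{k+1}N)`-periodic `Y` with `(Qcoarse L)^[k+1] Y = 0`, and every
site `z` whose torus image lies in the block `y₀`: `‖curlAt 1 X z μ ν‖ ≤ K·L^{k+1}·(a + e^{−cℓ}·b)` — the `hGloc` binder of F260 at `T Y :≡ (Qcoarse L)^[k+1] Y = 0` with
`K_G = K·M`, `ϵ = e^{−cℓ}`. [folklore] -/
theorem sliceGreen_flat_localised_straight [Nonempty n] {L : ℕ} (hL : 1 ≤ L) :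
    ∃ K c : ℝ, 0 ≤ K ∧ 0 < c ∧ ∀ (k N : ℕ) [NeZero N] [NeZero (L ^ (k + 1))] (y₀ : Tor (fun _ : Fin (d + 1) => N)) (ℓ : ℝ)
      (X : Site (d + 1) → Fin (d + 1) → Matrix n n ℂ), IsSkewDir X →
      IsPeriodicDir X ((L ^ (k + 1) * N : ℕ) : ℤ) → dirIter L (k + 1) (flat (d := d + 1) (n := n)) X = 0 →
      ∀ (Bn Bf : Finset (Site (d + 1))), Bn ⊆ periodBox (d := d + 1) (L ^ (k + 1) * N) → Bf ⊆ periodBox (d := d + 1) (L ^ (k + 1) * N) →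
      (∀ x ∈ Bf, ℓ ≤ torusSupNorm (fun _ : Fin (d + 1) => N) ((fun i => x i / ((L ^ (k + 1) : ℕ) : ℤ)) - rep (fun _ : Fin (d + 1) => N) y₀)) →
      ∀ a b : ℝ, 0 ≤ a → 0 ≤ b →
      (∀ Y : Site (d + 1) → Fin (d + 1) → Matrix n n ℂ, IsSkewDir Y → IsPeriodicDir Y ((L ^ (k + 1) * N : ℕ) : ℤ) →
        (Qcoarse L)^[k + 1] Y = 0 →
        |hess (flat (d := d + 1) (n := n)) X Y (perWin (d + 1) (L ^ (k + 1) * N))| ≤ a * dirL1 Y Bn + b * dirL1 Y Bf) →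
      ∀ (z : Site (d + 1)), B5Blocks16.blockOf (L ^ (k + 1)) (fun _ : Fin (d + 1) => N) (toT (fine (L ^ (k + 1)) (fun _ : Fin (d + 1) => N)) z) = y₀ →
      ∀ (μ ν : Fin (d + 1)), ‖curlAt (flat (d := d + 1) (n := n)) X z μ ν‖ ≤ K * (L : ℝ) ^ (k + 1) * (a + Real.exp (-(c * ℓ)) * b) := by
  obtain ⟨Ka, Kb, c, hKa, hKb, hc, hcore⟩ := exists_sliceGreen_localised_const (d := d)
  refine ⟨4 * (Fintype.card n : ℝ) ^ 3 * (Ka + Kb), c, by positivity, hc,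
    fun k N _ _ y₀ ℓ X hXs hXP hXT Bn Bf hBn hBf hfar a b ha hb hsrc z hz μ ν => ?_⟩
  haveI : NeZero (L ^ (k + 1) * N) := ⟨Nat.mul_ne_zero (NeZero.ne _) (NeZero.ne N)⟩
  have hnz : ((L ^ (k + 1) : ℕ) : ℂ) ≠ 0 := by exact_mod_cast NeZero.ne (L ^ (k + 1))
  have hcast : ((L ^ (k + 1) : ℕ) : ℝ) = (L : ℝ) ^ (k + 1) := by push_cast; ring
  have hMpos : (0 : ℝ) < ((L ^ (k + 1) : ℕ) : ℝ) := by exact_mod_cast Nat.pos_of_ne_zero (NeZero.ne (L ^ (k + 1)))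
  -- `z` read on the fine torus: a point of the block `y₀`
  have hzt : toT (fine (L ^ (k + 1)) (fun _ : Fin (d + 1) => N)) z
      = bpt (L ^ (k + 1)) (fun _ : Fin (d + 1) => N) y₀ (digitOf (L ^ (k + 1)) (fun _ : Fin (d + 1) => N) (toT (fine (L ^ (k + 1)) (fun _ : Fin (d + 1) => N)) z)) := by
    rw [← hz, bpt_blockOf_digitOf]
  -- the far bond set on the torus
  set Sf := (Finset.univ : Finset (Tor (fine (L ^ (k + 1)) (fun _ : Fin (d + 1) => N)) × Fin (d + 1))).filter
    (fun j => ℓ ≤ torusSupNorm (fun _ : Fin (d + 1) => N)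
      (rep (fun _ : Fin (d + 1) => N) (B5Blocks16.blockOf (L ^ (k + 1)) (fun _ : Fin (d + 1) => N) j.1) - rep (fun _ : Fin (d + 1) => N) y₀)) with hSfdef
  have hSf : ∀ j ∈ Sf, ℓ ≤ torusSupNorm (fun _ : Fin (d + 1) => N)
      (rep (fun _ : Fin (d + 1) => N) (B5Blocks16.blockOf (L ^ (k + 1)) (fun _ : Fin (d + 1) => N) j.1) - rep (fun _ : Fin (d + 1) => N) y₀) :=
    fun j hj => (Finset.mem_filter.mp hj).2
  -- the entry bound
  have hentry : ∀ i i' : n, ‖curlAt (flat (d := d + 1) (n := n)) X z μ ν i i'‖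
      ≤ 4 * (Fintype.card n : ℝ) ^ 2 * (Ka + Kb) * (L : ℝ) ^ (k + 1) * (a + Real.exp (-(c * ℓ)) * b) := by
    intro i i'
    obtain ⟨xt, hQ, hFs⟩ := exists_kerQ_entry (n := n) hL k N hXP hXT i i'
    have hpair := norm_curl_pairing_le_straight k N hXs hXP (rep (fun _ : Fin (d + 1) => N) y₀) ℓ Bn Bf hBn hBf hfar ha hb hsrc i i' xt hFs
    have hga0 : 0 ≤ 4 * ((L ^ (k + 1) : ℕ) : ℝ) ^ 2 * (Fintype.card n : ℝ) ^ 2 * a := by positivity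
    have hgb0 : 0 ≤ 4 * ((L ^ (k + 1) : ℕ) : ℝ) ^ 2 * (Fintype.card n : ℝ) ^ 2 * b := by positivity
    have hG1 := hcore (L ^ (k + 1)) (fun _ : Fin (d + 1) => N) xt hQ y₀ ℓ Sf hSf _ _ hga0 hgb0 (fun a'' ha'' => hpair a'' ha'') μ ν
      (digitOf (L ^ (k + 1)) (fun _ : Fin (d + 1) => N) (toT (fine (L ^ (k + 1)) (fun _ : Fin (d + 1) => N)) z))
    rw [← hzt] at hG1
    -- the entry is `n⁻¹·F_n(x̃)`
    have hent : curlAt (flat (d := d + 1) (n := n)) X z μ ν i i'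
        = (((L ^ (k + 1) : ℕ) : ℂ))⁻¹ * Fs (fine (L ^ (k + 1)) (fun _ : Fin (d + 1) => N)) ((L ^ (k + 1) : ℕ) : ℂ) xt μ ν
            (toT (fine (L ^ (k + 1)) (fun _ : Fin (d + 1) => N)) z) := by
      have h1 : curlAt (flat (d := d + 1) (n := n)) X z μ ν i i'
          = Fs (fine (L ^ (k + 1)) (fun _ : Fin (d + 1) => N)) 1
              (fun q : Tor (fine (L ^ (k + 1)) (fun _ : Fin (d + 1) => N)) × Fin (d + 1) =>
                X (rep (fine (L ^ (k + 1)) (fun _ : Fin (d + 1) => N)) q.1) q.2 i i') μ ν (toT (fine (L ^ (k + 1)) (fun _ : Fin (d + 1) => N)) z) :=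
        curlAt_flat_entry_torus (P := L ^ (k + 1) * N) hXP z μ ν i i'
      rw [h1, ← hFs, Fs_eq_mul_Fs_one _ (((L ^ (k + 1) : ℕ) : ℂ)), ← mul_assoc, inv_mul_cancel₀ hnz, one_mul]
    rw [hent, norm_mul, norm_inv, Complex.norm_natCast]
    refine (mul_le_mul_of_nonneg_left hG1 (by positivity)).trans ?_
    -- arithmetic: `M⁻¹·(K_a·g_a + K_b·e^{−cℓ}·g_b) ≤ 4(card n)²(K_a+K_b)·M·(a + e^{−cℓ}b)`
    rw [← hcast]
    have he0 : 0 ≤ Real.exp (-(c * ℓ)) := (Real.exp_pos _).le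
    have hcn : (0 : ℝ) ≤ (Fintype.card n : ℝ) ^ 2 := by positivity
    rw [inv_mul_le_iff₀ hMpos]
    have h1 : Ka * (4 * ((L ^ (k + 1) : ℕ) : ℝ) ^ 2 * (Fintype.card n : ℝ) ^ 2 * a)
        ≤ (Ka + Kb) * (4 * ((L ^ (k + 1) : ℕ) : ℝ) ^ 2 * (Fintype.card n : ℝ) ^ 2 * a) := by nlinarith
    have h2 : Kb * Real.exp (-(c * ℓ)) * (4 * ((L ^ (k + 1) : ℕ) : ℝ) ^ 2 * (Fintype.card n : ℝ) ^ 2 * b)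
        ≤ (Ka + Kb) * Real.exp (-(c * ℓ)) * (4 * ((L ^ (k + 1) : ℕ) : ℝ) ^ 2 * (Fintype.card n : ℝ) ^ 2 * b) := by
      have : 0 ≤ Real.exp (-(c * ℓ)) * (4 * ((L ^ (k + 1) : ℕ) : ℝ) ^ 2 * (Fintype.card n : ℝ) ^ 2 * b) := by positivity
      nlinarith
    calc Ka * (4 * ((L ^ (k + 1) : ℕ) : ℝ) ^ 2 * (Fintype.card n : ℝ) ^ 2 * a)
          + Kb * Real.exp (-(c * ℓ)) * (4 * ((L ^ (k + 1) : ℕ) : ℝ) ^ 2 * (Fintype.card n : ℝ) ^ 2 * b)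
        ≤ (Ka + Kb) * (4 * ((L ^ (k + 1) : ℕ) : ℝ) ^ 2 * (Fintype.card n : ℝ) ^ 2 * a)
          + (Ka + Kb) * Real.exp (-(c * ℓ)) * (4 * ((L ^ (k + 1) : ℕ) : ℝ) ^ 2 * (Fintype.card n : ℝ) ^ 2 * b) := add_le_add h1 h2
      _ = ((L ^ (k + 1) : ℕ) : ℝ) * (4 * (Fintype.card n : ℝ) ^ 2 * (Ka + Kb) * ((L ^ (k + 1) : ℕ) : ℝ) * (a + Real.exp (-(c * ℓ)) * b)) := by
          ring
  -- the operator norm from the entries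
  refine (opNorm_le_card_mul _ hentry).trans (le_of_eq ?_)
  ring

end

end Summit.QuantumFields.BalabanUV.T4Continuum.NE7SliceGreenFlatLocalisedStraight
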